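import Literature.NumberTheory.Sieve.CFSemigroupEigenfunctionUnique
import HarnessLib

/-!
# `C¹`-regularity of the Perron–Frobenius eigenfunctions of `Γ_A` (Magee–Oh–Winter §2.2, after Thm. 10)

Support file (all results proved) for the programme of proving [MageeOhWinter2019, Thm. 4 (2)] (Dolgopyat
bounds). [MageeOhWinter2019, §2.2]: "we need to note that Theorem 10 extends reasonably to `𝓛_f` acting on
`C¹(I)` … in particular `𝓛_f` acting on `C¹(I)` has the same spectral properties relative to a positive
eigenfunction `h_f ∈ C¹(I)`"; the Dolgopyat argument (§4.2) renormalises by `h_a` and works in the cone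
`|H'| ≤ A H`. The tree constructs, for every real `s ≥ 0`, a positive LIPSCHITZ eigenfunction `h` of the
real transfer operator `L_s` on `[0,1]` (`exists_cfTransfer_eigenfunction`: `L_s h = λ_s h`,
`4^{-s} ≤ h ≤ 4^s`). Here we prove that any Lipschitz eigenfunction is automatically `C¹` on `[0,1]`, with the
derivative in the cone `|h'| ≤ 2s h`:

* iterate the eigen-equation, `h = λ^{-n} L_s^n h = λ^{-n} Σ_{|w|=n} W_w · h ∘ M_w` (word sums of the tree);
  freezing `h` at the points `M_w y` gives smooth functions `F_{n,y}` with `F_{n,y}(y) = h(y)` and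
  `|h(x) - F_{n,y}(x)| ≤ C (1/2)^n |x - y|` (the branches `M_w` contract by `q_w^{-2} ≤ 2 (1/2)^n`), whence
  `h'(y) = lim_n F'_{n,y}(y) = lim_n λ^{-n} Σ_w W_w'(y) h(M_w y)` exists, is continuous, and
  `|h'| ≤ 2s λ^{-n} L_s^n h = 2s h` (`|W_w'| ≤ 2s W_w`).

Main results: `hasDerivWithinAt_of_eigen`, `continuousOn_cfHD`, `abs_cfHD_le`, packaged as
`exists_contDiff_eigenfunction`.

## References

* [MageeOhWinter2019] M. Magee, H. Oh, D. Winter, J. reine angew. Math. 753 (2019) 89–135, §2.2 (remark after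
  Thm. 10), §4.2–4.3.
-/

noncomputable section

open Set Filter
open scoped Topology

namespace Literature.NumberTheory.Sieve

variable {A : Finset ℕ} (hA : ∀ a ∈ A, 1 ≤ a)

/-! ### Word weights and their derivatives -/

section Weights

/-- The real word weight `W_w(x) = (denom(M_w, x)²)^{-s}` (the summand of `cfTransferSum`). [folklore] -/
def cfRealWt (s : ℝ) {n : ℕ} (w : Fin n → A) (x : ℝ) : ℝ := ((cfDenom (cfMat fun i => (w i : ℕ)) x) ^ 2) ^ (-s)

/-- The derivative `W_w'(x) = -2s (M₁₀/denom(M_w,x)) W_w(x)`. [folklore] -/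
def cfRealWtD (s : ℝ) {n : ℕ} (w : Fin n → A) (x : ℝ) : ℝ :=
  -(2 * s) * (((cfMat fun i => (w i : ℕ)) 1 0 : ℝ) / cfDenom (cfMat fun i => (w i : ℕ)) x) * cfRealWt s w x

include hA in
/-- **`W_w' = -2s (M₁₀/denom) W_w`** on `[0,1]`. [folklore] -/
theorem hasDerivAt_cfRealWt (s : ℝ) {n : ℕ} (w : Fin n → A) {x : ℝ} (hx : x ∈ Icc (0 : ℝ) 1) :
    HasDerivAt (cfRealWt s w) (cfRealWtD s w x) x := by
  set M := cfMat fun i => (w i : ℕ) with hM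
  have hw := one_le_coe_digit hA w
  have hd : 0 < cfDenom M x := cfDenom_cfMat_pos hw hx
  have hden : HasDerivAt (fun y : ℝ => cfDenom M y) (M 1 0 : ℝ) x := by
    unfold cfDenom
    simpa using ((hasDerivAt_id x).const_mul (M 1 0 : ℝ)).add_const (M 1 1 : ℝ)
  have hsq : HasDerivAt (fun y : ℝ => (cfDenom M y) ^ 2) (2 * cfDenom M x * (M 1 0 : ℝ)) x := by
    have h := hden.fun_mul hden
    have e : (fun y : ℝ => cfDenom M y * cfDenom M y) = fun y => (cfDenom M y) ^ 2 := funext fun y => by ring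
    rw [e] at h
    refine h.congr_deriv ?_
    ring
  have hpow := hsq.rpow_const (p := -s) (Or.inl (pow_pos hd 2).ne')
  unfold cfRealWt cfRealWtD
  refine hpow.congr_deriv ?_
  rw [← hM]
  have e : ((cfDenom M x) ^ 2) ^ (-s - 1) = ((cfDenom M x) ^ 2) ^ (-s) / (cfDenom M x) ^ 2 := by
    rw [Real.rpow_sub (pow_pos hd 2), Real.rpow_one]
  rw [e]
  unfold cfRealWt
  field_simp
  ring

include hA in
/-- `W_w > 0` on `[0,1]`. [folklore] -/
theorem cfRealWt_pos (s : ℝ) {n : ℕ} (w : Fin n → A) {x : ℝ} (hx : x ∈ Icc (0 : ℝ) 1) : 0 < cfRealWt s w x :=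
  Real.rpow_pos_of_pos (pow_pos (cfDenom_cfMat_pos (one_le_coe_digit hA w) hx) 2) _

include hA in
/-- **Cone bound for the weights:** `|W_w'| ≤ 2s W_w` on `[0,1]` (`0 ≤ M₁₀ ≤ M₁₁ ≤ denom`). [cite: MageeOhWinter2019, §4.3] -/
theorem abs_cfRealWtD_le {s : ℝ} (hs : 0 ≤ s) {n : ℕ} (w : Fin n → A) {x : ℝ} (hx : x ∈ Icc (0 : ℝ) 1) :
    |cfRealWtD s w x| ≤ 2 * s * cfRealWt s w x := by
  set M := cfMat fun i => (w i : ℕ) with hM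
  have hw := one_le_coe_digit hA w
  have hd : 0 < cfDenom M x := cfDenom_cfMat_pos hw hx
  have h10 : (0 : ℝ) ≤ (M 1 0 : ℝ) := by rw [hM]; exact_mod_cast cfWord_nonneg _ _ 1 0
  have h10q : (M 1 0 : ℝ) ≤ (M 1 1 : ℝ) := by
    have := cfWord_10_le_cfDen (one_le_cfExt hw) n
    rw [hM]; exact_mod_cast this
  have hratio : (M 1 0 : ℝ) / cfDenom M x ≤ 1 := by
    rw [div_le_one hd]
    have : cfDenom M x = (M 1 0 : ℝ) * x + M 1 1 := rfl
    nlinarith [hx.1]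
  have hratio0 : 0 ≤ (M 1 0 : ℝ) / cfDenom M x := div_nonneg h10 hd.le
  have hW := (cfRealWt_pos hA s w hx).le
  unfold cfRealWtD
  rw [← hM, abs_mul, abs_mul, abs_neg, abs_of_nonneg (by positivity : (0:ℝ) ≤ 2 * s), abs_of_nonneg hratio0,
    abs_of_nonneg hW]
  calc 2 * s * ((M 1 0 : ℝ) / cfDenom M x) * cfRealWt s w x ≤ 2 * s * 1 * cfRealWt s w x := by gcongr
    _ = 2 * s * cfRealWt s w x := by ring

include hA in
/-- **Contraction of the branches:** `|M_w x - M_w y| ≤ 2 (1/2)^n |x - y|` on `[0,1]` for `|w| = n`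
(`q_w² ≥ 2^{n-1}`). [cite: MageeOhWinter2019, Prop. 5] -/
theorem abs_cfMoeb_word_sub_le {n : ℕ} (w : Fin n → A) {x y : ℝ} (hx : x ∈ Icc (0 : ℝ) 1) (hy : y ∈ Icc (0 : ℝ) 1) :
    |cfMoeb (cfMat fun i => (w i : ℕ)) x - cfMoeb (cfMat fun i => (w i : ℕ)) y| ≤ 2 * (1 / 2) ^ n * |x - y| := by
  have hw := one_le_coe_digit hA w
  refine (abs_cfMoeb_sub_cfMoeb_le hw hx hy).trans ?_
  have hq : (2 : ℝ) ^ (n - 1) ≤ (cfQ (fun i => (w i : ℕ)) : ℝ) ^ 2 := by exact_mod_cast pow_le_cfQ_sq hw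
  have hq0 : (0 : ℝ) < (cfQ (fun i => (w i : ℕ)) : ℝ) ^ 2 := lt_of_lt_of_le (by positivity) hq
  rw [div_le_iff₀ hq0]
  have h2 : 2 * (1 / 2 : ℝ) ^ n * (2 : ℝ) ^ (n - 1) ≥ 1 := by
    rcases n with _ | k
    · norm_num
    · rw [Nat.add_sub_cancel, pow_succ]
      have : (1 / 2 : ℝ) ^ k * 2 ^ k = 1 := by rw [← mul_pow]; norm_num
      nlinarith [this]
  nlinarith [abs_nonneg (x - y), mul_le_mul_of_nonneg_left hq (by positivity : (0:ℝ) ≤ 2 * (1 / 2) ^ n * |x - y|)]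

end Weights

/-! ### Frozen iterates, their derivatives, and the approximation of `h` -/

section Frozen

variable {s : ℝ} (hs : 0 ≤ s) {h : ℝ → ℝ} {Lh : ℝ} (hLh : 0 ≤ Lh)
  (hlip : ∀ x ∈ Icc (0 : ℝ) 1, ∀ y ∈ Icc (0 : ℝ) 1, |h x - h y| ≤ Lh * |x - y|)
  (heig : ∀ x ∈ Icc (0 : ℝ) 1, cfTransfer A s h x = cfEig A s * h x)

/-- The frozen iterate `F_{n,y}(x) = λ^{-n} Σ_{|w|=n} W_w(x) h(M_w y)`. [folklore] -/
def cfFrozen (A : Finset ℕ) (s : ℝ) (h : ℝ → ℝ) (n : ℕ) (y x : ℝ) : ℝ :=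
  (cfEig A s ^ n)⁻¹ * ∑ w : Fin n → A, cfRealWt s w x * h (cfMoeb (cfMat fun i => (w i : ℕ)) y)

/-- `D_n(y) = F'_{n,y}(y) = λ^{-n} Σ_{|w|=n} W_w'(y) h(M_w y)`. [folklore] -/
def cfDn (A : Finset ℕ) (s : ℝ) (h : ℝ → ℝ) (n : ℕ) (y : ℝ) : ℝ :=
  (cfEig A s ^ n)⁻¹ * ∑ w : Fin n → A, cfRealWtD s w y * h (cfMoeb (cfMat fun i => (w i : ℕ)) y)

include hA in
/-- `F_{n,y}` is differentiable at `y` with derivative `D_n(y)`. [folklore] -/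
theorem hasDerivAt_cfFrozen (s : ℝ) (h : ℝ → ℝ) (n : ℕ) {y : ℝ} (hy : y ∈ Icc (0 : ℝ) 1) :
    HasDerivAt (cfFrozen A s h n y) (cfDn A s h n y) y := by
  unfold cfFrozen cfDn
  refine HasDerivAt.const_mul _ ?_
  have hsum := HasDerivAt.sum (u := Finset.univ) (A := fun (w : Fin n → A) x => cfRealWt s w x * h (cfMoeb (cfMat fun i => (w i : ℕ)) y))
    (A' := fun w => cfRealWtD s w y * h (cfMoeb (cfMat fun i => (w i : ℕ)) y)) (x := y)
    fun w _ => (hasDerivAt_cfRealWt hA s w hy).mul_const _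
  have e : (∑ w ∈ (Finset.univ : Finset (Fin n → A)), fun x => cfRealWt s w x * h (cfMoeb (cfMat fun i => (w i : ℕ)) y)) =
      fun x => ∑ w : Fin n → A, cfRealWt s w x * h (cfMoeb (cfMat fun i => (w i : ℕ)) y) := by
    funext x; simp only [Finset.sum_apply]
  rw [e] at hsum
  exact hsum

include hA heig in
/-- The unfrozen iterate reproduces `h`: `λ^{-n} Σ_w W_w(x) h(M_w x) = h(x)` on `[0,1]`. [folklore] -/
theorem cfFrozen_diag {x : ℝ} (hx : x ∈ Icc (0 : ℝ) 1) (n : ℕ) :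
    (cfEig A s ^ n)⁻¹ * ∑ w : Fin n → A, cfRealWt s w x * h (cfMoeb (cfMat fun i => (w i : ℕ)) x) = h x := by
  have hlam : 0 < cfEig A s ^ n := pow_pos (cfEig_pos s) n
  have hit := cfTransfer_iterate_of_eigen hA heig n hx
  rw [cfTransfer_iterate hA s h n hx, cfTransferSum] at hit
  have e : ∑ w : Fin n → A, cfRealWt s w x * h (cfMoeb (cfMat fun i => (w i : ℕ)) x) = cfEig A s ^ n * h x := hit
  rw [e, ← mul_assoc, inv_mul_cancel₀ hlam.ne', one_mul]

include hA heig in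
/-- `F_{n,y}(y) = h(y)`. [folklore] -/
theorem cfFrozen_self {y : ℝ} (hy : y ∈ Icc (0 : ℝ) 1) (n : ℕ) : cfFrozen A s h n y y = h y :=
  cfFrozen_diag hA heig hy n

include hA hs hLh hlip heig in
/-- **Approximation:** `|h(x) - F_{n,y}(x)| ≤ 2·4^s·L_h (1/2)^n |x - y|` for `x, y ∈ [0,1]` (Gibbs bound
`Σ_w W_w(x) ≤ 4^s λ^n` and the contraction of the branches). [cite: MageeOhWinter2019, §2.2] -/
theorem abs_sub_cfFrozen_le (hne : A.Nonempty) {x y : ℝ} (hx : x ∈ Icc (0 : ℝ) 1) (hy : y ∈ Icc (0 : ℝ) 1) (n : ℕ) :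
    |h x - cfFrozen A s h n y x| ≤ 2 * (4 : ℝ) ^ s * Lh * (1 / 2) ^ n * |x - y| := by
  have hlam : 0 < cfEig A s ^ n := pow_pos (cfEig_pos s) n
  rw [← cfFrozen_diag hA heig hx n, cfFrozen, ← mul_sub, ← Finset.sum_sub_distrib, abs_mul, abs_of_pos (inv_pos.2 hlam)]
  have hterm : ∀ w : Fin n → A, |cfRealWt s w x * h (cfMoeb (cfMat fun i => (w i : ℕ)) x) -
      cfRealWt s w x * h (cfMoeb (cfMat fun i => (w i : ℕ)) y)| ≤ cfRealWt s w x * (Lh * (2 * (1 / 2) ^ n * |x - y|)) := by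
    intro w
    have hw := one_le_coe_digit hA w
    rw [← mul_sub, abs_mul, abs_of_pos (cfRealWt_pos hA s w hx)]
    refine mul_le_mul_of_nonneg_left ?_ (cfRealWt_pos hA s w hx).le
    exact (hlip _ (cfMoeb_cfMat_mem hw hx) _ (cfMoeb_cfMat_mem hw hy)).trans
      (mul_le_mul_of_nonneg_left (abs_cfMoeb_word_sub_le hA w hx hy) hLh)
  have hsum : |∑ w : Fin n → A, (cfRealWt s w x * h (cfMoeb (cfMat fun i => (w i : ℕ)) x) -
      cfRealWt s w x * h (cfMoeb (cfMat fun i => (w i : ℕ)) y))| ≤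
      (∑ w : Fin n → A, cfRealWt s w x) * (Lh * (2 * (1 / 2) ^ n * |x - y|)) := by
    refine (Finset.abs_sum_le_sum_abs _ _).trans ?_
    rw [Finset.sum_mul]
    exact Finset.sum_le_sum fun w _ => hterm w
  have hgibbs : ∑ w : Fin n → A, cfRealWt s w x ≤ (4 : ℝ) ^ s * cfEig A s ^ n := by
    have h1 : ∑ w : Fin n → A, cfRealWt s w x = (cfTransfer A s)^[n] (fun _ => 1) x := by
      rw [cfTransfer_iterate hA s _ n hx, cfTransferSum]
      exact Finset.sum_congr rfl fun w _ => by unfold cfRealWt; ring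
    rw [h1]
    have := (cfTransfer_iterate_one_div_mem hA hne hs n hx).2
    rwa [div_le_iff₀ hlam] at this
  calc (cfEig A s ^ n)⁻¹ * |∑ w : Fin n → A, (cfRealWt s w x * h (cfMoeb (cfMat fun i => (w i : ℕ)) x) -
          cfRealWt s w x * h (cfMoeb (cfMat fun i => (w i : ℕ)) y))|
      ≤ (cfEig A s ^ n)⁻¹ * (((4 : ℝ) ^ s * cfEig A s ^ n) * (Lh * (2 * (1 / 2) ^ n * |x - y|))) := by
        refine mul_le_mul_of_nonneg_left (hsum.trans ?_) (inv_nonneg.2 hlam.le)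
        exact mul_le_mul_of_nonneg_right hgibbs (by positivity)
    _ = 2 * (4 : ℝ) ^ s * Lh * (1 / 2) ^ n * |x - y| := by field_simp

include hA hs heig in
/-- **Cone bound for the approximate derivatives:** `|D_n(y)| ≤ 2s λ^{-n} Σ_w W_w(y)|h(M_w y)|`; for a
positive eigenfunction this is `2s h(y)`. [cite: MageeOhWinter2019, §4.3] -/
theorem abs_cfDn_le (hpos : ∀ x ∈ Icc (0 : ℝ) 1, 0 ≤ h x) {y : ℝ} (hy : y ∈ Icc (0 : ℝ) 1) (n : ℕ) :
    |cfDn A s h n y| ≤ 2 * s * h y := by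
  have hlam : 0 < cfEig A s ^ n := pow_pos (cfEig_pos s) n
  rw [cfDn, abs_mul, abs_of_pos (inv_pos.2 hlam)]
  have hterm : ∀ w : Fin n → A, |cfRealWtD s w y * h (cfMoeb (cfMat fun i => (w i : ℕ)) y)| ≤
      2 * s * (cfRealWt s w y * h (cfMoeb (cfMat fun i => (w i : ℕ)) y)) := fun w => by
    have hw := one_le_coe_digit hA w
    have hhy := hpos _ (cfMoeb_cfMat_mem hw hy)
    rw [abs_mul, abs_of_nonneg hhy]
    calc |cfRealWtD s w y| * h (cfMoeb (cfMat fun i => (w i : ℕ)) y) ≤ (2 * s * cfRealWt s w y) * h _ :=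
          mul_le_mul_of_nonneg_right (abs_cfRealWtD_le hA hs w hy) hhy
      _ = _ := by ring
  have hsum := (Finset.abs_sum_le_sum_abs _ _).trans (Finset.sum_le_sum fun w (_ : w ∈ Finset.univ) => hterm w)
  rw [← Finset.mul_sum] at hsum
  have hdiag := cfFrozen_diag hA heig hy n
  calc (cfEig A s ^ n)⁻¹ * |∑ w : Fin n → A, cfRealWtD s w y * h (cfMoeb (cfMat fun i => (w i : ℕ)) y)|
      ≤ (cfEig A s ^ n)⁻¹ * (2 * s * ∑ w : Fin n → A, cfRealWt s w y * h (cfMoeb (cfMat fun i => (w i : ℕ)) y)) :=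
        mul_le_mul_of_nonneg_left hsum (inv_nonneg.2 hlam.le)
    _ = 2 * s * ((cfEig A s ^ n)⁻¹ * ∑ w : Fin n → A, cfRealWt s w y * h (cfMoeb (cfMat fun i => (w i : ℕ)) y)) := by ring
    _ = 2 * s * h y := by rw [hdiag]

end Frozen

/-! ### The derivative as the limit of `D_n` -/

section Limit

variable {s : ℝ} (hs : 0 ≤ s) {h : ℝ → ℝ} {Lh : ℝ} (hLh : 0 ≤ Lh)
  (hlip : ∀ x ∈ Icc (0 : ℝ) 1, ∀ y ∈ Icc (0 : ℝ) 1, |h x - h y| ≤ Lh * |x - y|)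
  (heig : ∀ x ∈ Icc (0 : ℝ) 1, cfTransfer A s h x = cfEig A s * h x)

/-- A sequence in `[0,1] \\ {y}` tending to `y ∈ [0,1]`. [folklore] -/
def cfApproach (y : ℝ) (k : ℕ) : ℝ := if y ≤ 1 / 2 then y + 1 / ((k : ℝ) + 2) else y - 1 / ((k : ℝ) + 2)

/-- Properties of the approaching sequence. [folklore] -/
theorem cfApproach_spec {y : ℝ} (hy : y ∈ Icc (0 : ℝ) 1) (k : ℕ) :
    cfApproach y k ∈ Icc (0 : ℝ) 1 ∧ cfApproach y k ≠ y ∧ |cfApproach y k - y| = 1 / ((k : ℝ) + 2) := by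
  have hk : (0 : ℝ) < 1 / ((k : ℝ) + 2) := by positivity
  have hk2 : 1 / ((k : ℝ) + 2) ≤ 1 / 2 :=
    div_le_div_of_nonneg_left zero_le_one (by norm_num) (by linarith [(Nat.cast_nonneg (α := ℝ) k)])
  unfold cfApproach
  split_ifs with hle
  · refine ⟨⟨by linarith [hy.1], by linarith⟩, by linarith, ?_⟩
    rw [add_sub_cancel_left, abs_of_pos hk]
  · push Not at hle
    refine ⟨⟨by linarith, by linarith [hy.2]⟩, by linarith, ?_⟩
    rw [show y - 1 / ((k : ℝ) + 2) - y = -(1 / ((k : ℝ) + 2)) by ring, abs_neg, abs_of_pos hk]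

/-- The approaching sequence tends to `y` within the punctured line. [folklore] -/
theorem tendsto_cfApproach {y : ℝ} (hy : y ∈ Icc (0 : ℝ) 1) :
    Tendsto (cfApproach y) atTop (𝓝[≠] y) := by
  refine tendsto_nhdsWithin_iff.2 ⟨?_, Eventually.of_forall fun k => (cfApproach_spec hy k).2.1⟩
  rw [tendsto_iff_norm_sub_tendsto_zero]
  have : (fun k => ‖cfApproach y k - y‖) = fun k : ℕ => 1 / ((k : ℝ) + 2) :=
    funext fun k => by rw [Real.norm_eq_abs, (cfApproach_spec hy k).2.2]
  rw [this]
  have h := (tendsto_one_div_add_atTop_nhds_zero_nat (𝕜 := ℝ)).comp (tendsto_add_atTop_nat 1)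
  refine h.congr fun k => ?_
  simp only [Function.comp_apply, Nat.cast_add, Nat.cast_one]; ring

include hA hs hLh hlip heig in
/-- **The approximate derivatives form a Cauchy sequence:** `|D_n(y) - D_m(y)| ≤ C((1/2)^n + (1/2)^m)`,
`C = 2·4^s L_h`. [cite: MageeOhWinter2019, §2.2] -/
theorem abs_cfDn_sub_cfDn_le (hne : A.Nonempty) {y : ℝ} (hy : y ∈ Icc (0 : ℝ) 1) (n m : ℕ) :
    |cfDn A s h n y - cfDn A s h m y| ≤ 2 * (4 : ℝ) ^ s * Lh * ((1 / 2) ^ n + (1 / 2) ^ m) := by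
  set C : ℝ := 2 * (4 : ℝ) ^ s * Lh with hC
  set x : ℕ → ℝ := cfApproach y with hxdef
  -- slopes of the frozen iterates converge to `D_n`, `D_m`
  have hsl : ∀ k : ℕ, Tendsto (fun j => slope (cfFrozen A s h k y) y (x j)) atTop (𝓝 (cfDn A s h k y)) :=
    fun k => ((hasDerivAt_cfFrozen hA s h k hy).tendsto_slope).comp (tendsto_cfApproach hy)
  -- the slopes of `F_n` and `F_m` differ by at most `C((1/2)^n + (1/2)^m)`
  have hdiff : ∀ j, |slope (cfFrozen A s h n y) y (x j) - slope (cfFrozen A s h m y) y (x j)| ≤ C * ((1 / 2) ^ n + (1 / 2) ^ m) := by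
    intro j
    obtain ⟨hxj, hne', habs⟩ := cfApproach_spec hy j
    have hxy : x j - y ≠ 0 := sub_ne_zero.2 hne'
    rw [slope_def_field, slope_def_field, cfFrozen_self hA heig hy n, cfFrozen_self hA heig hy m, ← sub_div, abs_div]
    rw [div_le_iff₀ (abs_pos.2 hxy)]
    have h1 := abs_sub_cfFrozen_le hA hs hLh hlip heig hne hxj hy n
    have h2 := abs_sub_cfFrozen_le hA hs hLh hlip heig hne hxj hy m
    have e : cfFrozen A s h n y (x j) - h y - (cfFrozen A s h m y (x j) - h y) =
        (h (x j) - cfFrozen A s h m y (x j)) - (h (x j) - cfFrozen A s h n y (x j)) := by ring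
    rw [e]
    refine (abs_sub _ _).trans ?_
    rw [hC]; nlinarith [abs_nonneg (x j - y)]
  -- pass to the limit
  have hlim : Tendsto (fun j => |(cfDn A s h n y - slope (cfFrozen A s h n y) y (x j)) +
      (slope (cfFrozen A s h n y) y (x j) - slope (cfFrozen A s h m y) y (x j)) +
      (slope (cfFrozen A s h m y) y (x j) - cfDn A s h m y)|) atTop (𝓝 |cfDn A s h n y - cfDn A s h m y|) := by
    have : (fun j => |(cfDn A s h n y - slope (cfFrozen A s h n y) y (x j)) +
        (slope (cfFrozen A s h n y) y (x j) - slope (cfFrozen A s h m y) y (x j)) +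
        (slope (cfFrozen A s h m y) y (x j) - cfDn A s h m y)|) = fun _ => |cfDn A s h n y - cfDn A s h m y| :=
      funext fun j => by ring_nf
    rw [this]; exact tendsto_const_nhds
  have t1 : Tendsto (fun j => |cfDn A s h n y - slope (cfFrozen A s h n y) y (x j)|) atTop (𝓝 0) := by
    have := ((tendsto_const_nhds (x := cfDn A s h n y)).sub (hsl n)).abs
    simpa using this
  have t3 : Tendsto (fun j => |slope (cfFrozen A s h m y) y (x j) - cfDn A s h m y|) atTop (𝓝 0) := by
    have := ((hsl m).sub (tendsto_const_nhds (x := cfDn A s h m y))).abs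
    simpa using this
  have hbd : Tendsto (fun j => |cfDn A s h n y - slope (cfFrozen A s h n y) y (x j)| + C * ((1 / 2) ^ n + (1 / 2) ^ m) +
      |slope (cfFrozen A s h m y) y (x j) - cfDn A s h m y|) atTop (𝓝 (0 + C * ((1 / 2) ^ n + (1 / 2) ^ m) + 0)) :=
    (t1.add tendsto_const_nhds).add t3
  have hle : ∀ j, |(cfDn A s h n y - slope (cfFrozen A s h n y) y (x j)) +
      (slope (cfFrozen A s h n y) y (x j) - slope (cfFrozen A s h m y) y (x j)) +
      (slope (cfFrozen A s h m y) y (x j) - cfDn A s h m y)| ≤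
      |cfDn A s h n y - slope (cfFrozen A s h n y) y (x j)| + C * ((1 / 2) ^ n + (1 / 2) ^ m) +
      |slope (cfFrozen A s h m y) y (x j) - cfDn A s h m y| := fun j =>
    (abs_add_three _ _ _).trans (by linarith [hdiff j])
  have := le_of_tendsto_of_tendsto' hlim hbd hle
  simpa using this

/-- The derivative `h'(y) = lim_n D_n(y)`. [folklore] -/
def cfHD (A : Finset ℕ) (s : ℝ) (h : ℝ → ℝ) (y : ℝ) : ℝ := limUnder atTop fun n => cfDn A s h n y

include hA hs hLh hlip heig in
/-- `D_n(y) → h'(y)` with `|D_n(y) - h'(y)| ≤ 2 C (1/2)^n`. [folklore] -/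
theorem tendsto_cfDn (hne : A.Nonempty) {y : ℝ} (hy : y ∈ Icc (0 : ℝ) 1) :
    Tendsto (fun n => cfDn A s h n y) atTop (𝓝 (cfHD A s h y)) ∧
      ∀ n, |cfDn A s h n y - cfHD A s h y| ≤ 2 * (4 : ℝ) ^ s * Lh * (2 * (1 / 2) ^ n) := by
  set C : ℝ := 2 * (4 : ℝ) ^ s * Lh with hC
  have hC0 : 0 ≤ C := by positivity
  have hcauchy : CauchySeq fun n => cfDn A s h n y := by
    refine Metric.cauchySeq_iff'.2 fun ε hε => ?_
    obtain ⟨N, hN⟩ := exists_pow_lt_of_lt_one (show 0 < ε / (2 * C + 1) by positivity) (by norm_num : (1 / 2 : ℝ) < 1)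
    refine ⟨N, fun n hn => ?_⟩
    rw [Real.dist_eq]
    have hpow : (1 / 2 : ℝ) ^ n ≤ (1 / 2) ^ N := pow_le_pow_of_le_one (by norm_num) (by norm_num) hn
    have h := abs_cfDn_sub_cfDn_le hA hs hLh hlip heig hne hy n N
    have hε' : (2 * C + 1) * (1 / 2 : ℝ) ^ N < ε := by rwa [lt_div_iff₀ (by positivity), mul_comm] at hN
    nlinarith [pow_nonneg (by norm_num : (0:ℝ) ≤ 1/2) N]
  have hconv : Tendsto (fun n => cfDn A s h n y) atTop (𝓝 (cfHD A s h y)) := hcauchy.tendsto_limUnder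
  refine ⟨hconv, fun n => ?_⟩
  have hev : ∀ m, |cfDn A s h n y - cfDn A s h m y| ≤ C * ((1 / 2) ^ n + (1 / 2) ^ m) :=
    fun m => abs_cfDn_sub_cfDn_le hA hs hLh hlip heig hne hy n m
  have hlim1 : Tendsto (fun m => |cfDn A s h n y - cfDn A s h m y|) atTop (𝓝 |cfDn A s h n y - cfHD A s h y|) :=
    ((tendsto_const_nhds (x := cfDn A s h n y)).sub hconv).abs
  have hlim2 : Tendsto (fun m : ℕ => C * ((1 / 2) ^ n + (1 / 2 : ℝ) ^ m)) atTop (𝓝 (C * ((1 / 2) ^ n + 0))) :=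
    (tendsto_const_nhds.add (tendsto_pow_atTop_nhds_zero_of_lt_one (by norm_num) (by norm_num))).const_mul C
  have := le_of_tendsto_of_tendsto' hlim1 hlim2 hev
  nlinarith [pow_nonneg (by norm_num : (0:ℝ) ≤ 1/2) n]

include hA hs hLh hlip heig in
/-- **Lipschitz eigenfunctions are differentiable:** `h` has derivative `h'(y) = lim_n D_n(y)` within `[0,1]`
at every `y ∈ [0,1]`. [cite: MageeOhWinter2019, §2.2 (remark after Thm. 10)] -/
theorem hasDerivWithinAt_of_eigen (hne : A.Nonempty) {y : ℝ} (hy : y ∈ Icc (0 : ℝ) 1) :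
    HasDerivWithinAt h (cfHD A s h y) (Icc (0 : ℝ) 1) y := by
  set C : ℝ := 2 * (4 : ℝ) ^ s * Lh with hC
  have hC0 : 0 ≤ C := by positivity
  rw [hasDerivWithinAt_iff_tendsto_slope, Metric.tendsto_nhds]
  intro ε hε
  obtain ⟨n, hn⟩ := exists_pow_lt_of_lt_one (show 0 < ε / (4 * C + 4) by positivity) (by norm_num : (1 / 2 : ℝ) < 1)
  have hDn := (tendsto_cfDn hA hs hLh hlip heig hne hy).2 n
  -- slopes of `F_n` are eventually `ε/4`-close to `D_n`
  have hF : ∀ᶠ x in 𝓝[≠] y, dist (slope (cfFrozen A s h n y) y x) (cfDn A s h n y) < ε / 4 :=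
    Metric.tendsto_nhds.1 (hasDerivAt_cfFrozen hA s h n hy).tendsto_slope (ε / 4) (by positivity)
  have hsub : 𝓝[Icc (0 : ℝ) 1 \ {y}] y ≤ 𝓝[≠] y := nhdsWithin_mono _ fun x hx => hx.2
  have hmem : ∀ᶠ x in 𝓝[Icc (0 : ℝ) 1 \ {y}] y, x ∈ Icc (0 : ℝ) 1 \ {y} := eventually_mem_nhdsWithin
  filter_upwards [hsub hF, hmem] with x hx hxm
  have hxI : x ∈ Icc (0 : ℝ) 1 := hxm.1
  have hxy : x - y ≠ 0 := sub_ne_zero.2 hxm.2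
  -- `|slope h - slope F_n| ≤ C (1/2)^n`
  have h1 : |slope h y x - slope (cfFrozen A s h n y) y x| ≤ C * (1 / 2) ^ n := by
    rw [slope_def_field, slope_def_field, cfFrozen_self hA heig hy n, ← sub_div, abs_div, div_le_iff₀ (abs_pos.2 hxy)]
    have e : h x - h y - (cfFrozen A s h n y x - h y) = h x - cfFrozen A s h n y x := by ring
    rw [e]
    exact abs_sub_cfFrozen_le hA hs hLh hlip heig hne hxI hy n
  rw [Real.dist_eq] at hx ⊢
  have hε4 : (4 * C + 4) * (1 / 2 : ℝ) ^ n < ε := by rwa [lt_div_iff₀ (by positivity), mul_comm] at hn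
  calc |slope h y x - cfHD A s h y|
      ≤ |slope h y x - slope (cfFrozen A s h n y) y x| + |slope (cfFrozen A s h n y) y x - cfDn A s h n y| +
          |cfDn A s h n y - cfHD A s h y| := abs_sub_le_of_three _ _ _ _
    _ < C * (1 / 2) ^ n + ε / 4 + C * (2 * (1 / 2) ^ n) := by linarith [h1, hx, hDn]
    _ ≤ ε := by nlinarith [pow_nonneg (by norm_num : (0:ℝ) ≤ 1/2) n]
  where
  /-- `|a - d| ≤ |a - b| + |b - c| + |c - d|`. [folklore] -/
  abs_sub_le_of_three (a b c d : ℝ) : |a - d| ≤ |a - b| + |b - c| + |c - d| :=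
    (abs_sub_le a c d).trans (by linarith [abs_sub_le a b c])

include hA in
/-- Each `D_n` is continuous on `[0,1]` (given `h` continuous on `[0,1]`). [folklore] -/
theorem continuousOn_cfDn (hcont : ContinuousOn h (Icc (0 : ℝ) 1)) (n : ℕ) :
    ContinuousOn (cfDn A s h n) (Icc (0 : ℝ) 1) := by
  unfold cfDn
  refine continuousOn_const.mul (continuousOn_finsetSum _ fun w _ => ?_)
  have hw := one_le_coe_digit hA w
  have hden : ContinuousOn (fun y : ℝ => cfDenom (cfMat fun i => (w i : ℕ)) y) (Icc (0 : ℝ) 1) := by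
    unfold cfDenom; fun_prop
  have hden0 : ∀ y ∈ Icc (0 : ℝ) 1, cfDenom (cfMat fun i => (w i : ℕ)) y ≠ 0 := fun y hy => (cfDenom_cfMat_pos hw hy).ne'
  have hW : ContinuousOn (cfRealWt s w) (Icc (0 : ℝ) 1) := by
    unfold cfRealWt
    exact (hden.pow 2).rpow_const fun y hy => Or.inl (pow_pos (cfDenom_cfMat_pos hw hy) 2).ne'
  have hWD : ContinuousOn (cfRealWtD s w) (Icc (0 : ℝ) 1) := by
    unfold cfRealWtD
    exact (continuousOn_const.mul (continuousOn_const.div hden hden0)).mul hW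
  have hM : ContinuousOn (fun y : ℝ => cfMoeb (cfMat fun i => (w i : ℕ)) y) (Icc (0 : ℝ) 1) := by
    unfold cfMoeb
    refine ContinuousOn.div (by fun_prop) hden hden0
  exact hWD.mul (hcont.comp hM fun y hy => cfMoeb_cfMat_mem hw hy)

include hA hs hLh hlip heig in
/-- **The derivative is continuous on `[0,1]`** (uniform limit of the continuous `D_n`). [cite: MageeOhWinter2019, §2.2] -/
theorem continuousOn_cfHD (hne : A.Nonempty) : ContinuousOn (cfHD A s h) (Icc (0 : ℝ) 1) := by
  set C : ℝ := 2 * (4 : ℝ) ^ s * Lh with hC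
  have hcont : ContinuousOn h (Icc (0 : ℝ) 1) := by
    have hL : LipschitzOnWith Lh.toNNReal h (Icc 0 1) := LipschitzOnWith.of_dist_le_mul fun x hx y hy => by
      rw [Real.dist_eq, Real.dist_eq, Real.coe_toNNReal _ hLh]; exact hlip x hx y hy
    exact hL.continuousOn
  have hunif : TendstoUniformlyOn (fun n => cfDn A s h n) (cfHD A s h) atTop (Icc (0 : ℝ) 1) := by
    refine Metric.tendstoUniformlyOn_iff.2 fun ε hε => ?_
    obtain ⟨N, hN⟩ := exists_pow_lt_of_lt_one (show 0 < ε / (4 * C + 1) by positivity) (by norm_num : (1 / 2 : ℝ) < 1)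
    refine eventually_atTop.2 ⟨N, fun n hn y hy => ?_⟩
    have h := (tendsto_cfDn hA hs hLh hlip heig hne hy).2 n
    rw [← hC] at h
    have hC0 : 0 ≤ C := by rw [hC]; positivity
    have hpow : (1 / 2 : ℝ) ^ n ≤ (1 / 2) ^ N := pow_le_pow_of_le_one (by norm_num) (by norm_num) hn
    rw [Real.dist_eq, abs_sub_comm]
    have hε' : (4 * C + 1) * (1 / 2 : ℝ) ^ N < ε := by rwa [lt_div_iff₀ (by positivity), mul_comm] at hN
    have h2 : C * (2 * (1 / 2 : ℝ) ^ n) ≤ 2 * C * (1 / 2) ^ N := by nlinarith [mul_le_mul_of_nonneg_left hpow hC0]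
    nlinarith [pow_nonneg (by norm_num : (0:ℝ) ≤ 1/2) N]
  exact hunif.continuousOn (Frequently.of_forall fun n => continuousOn_cfDn hA hcont n)

include hA hs hLh hlip heig in
/-- **Cone bound for the derivative of a positive eigenfunction:** `|h'(y)| ≤ 2s h(y)` on `[0,1]`.
[cite: MageeOhWinter2019, §4.3] -/
theorem abs_cfHD_le (hne : A.Nonempty) (hpos : ∀ x ∈ Icc (0 : ℝ) 1, 0 ≤ h x) {y : ℝ} (hy : y ∈ Icc (0 : ℝ) 1) :
    |cfHD A s h y| ≤ 2 * s * h y :=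
  le_of_tendsto ((tendsto_cfDn hA hs hLh hlip heig hne hy).1.abs)
    (Eventually.of_forall fun n => abs_cfDn_le hA hs heig hpos hy n)

end Limit

/-! ### The packaged statement -/

/-- **`C¹` Perron–Frobenius eigenfunctions.** For every real `s ≥ 0` the transfer operator `L_s` of `Γ_A`
(`#A ≥ 1`, letters `≥ 1`) has an eigenfunction `h` on `[0,1]` with eigenvalue `λ_s = e^{P_A(s)}` which is
positive (`4^{-s} ≤ h ≤ 4^s`), `C¹` on `[0,1]` (derivative `h'` within `[0,1]` at every point, continuous on
`[0,1]`) and in the cone `|h'| ≤ 2s h`. [cite: MageeOhWinter2019, §2.2 (Thm. 10 and the remark following it)] -/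
theorem exists_contDiff_eigenfunction (hA : ∀ a ∈ A, 1 ≤ a) (hne : A.Nonempty) {s : ℝ} (hs : 0 ≤ s) :
    ∃ h h' : ℝ → ℝ,
      (∀ x ∈ Icc (0 : ℝ) 1, h x ∈ Icc ((4 : ℝ) ^ (-s)) ((4 : ℝ) ^ s)) ∧
      (∀ x ∈ Icc (0 : ℝ) 1, cfTransfer A s h x = cfEig A s * h x) ∧
      (∀ x ∈ Icc (0 : ℝ) 1, HasDerivWithinAt h (h' x) (Icc (0 : ℝ) 1) x) ∧
      ContinuousOn h' (Icc (0 : ℝ) 1) ∧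
      (∀ x ∈ Icc (0 : ℝ) 1, |h' x| ≤ 2 * s * h x) := by
  obtain ⟨h, hbd, hlip, heig⟩ := exists_cfTransfer_eigenfunction hA hne hs
  have hLh : 0 ≤ (4 : ℝ) ^ s * (2 * s * Real.exp (2 * s)) := by positivity
  have hpos : ∀ x ∈ Icc (0 : ℝ) 1, 0 ≤ h x := fun x hx => (Real.rpow_pos_of_pos (by norm_num) _).le.trans (hbd x hx).1
  exact ⟨h, cfHD A s h, hbd, heig, fun x hx => hasDerivWithinAt_of_eigen hA hs hLh hlip heig hne hx,
    continuousOn_cfHD hA hs hLh hlip heig hne, fun x hx => abs_cfHD_le hA hs hLh hlip heig hne hpos hx⟩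

end Literature.NumberTheory.Sieve
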